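import Summits.AtomisticToContinuum.BoseEinsteinCondensation.Theorems.InfraredMinimumUncertainty.Negative.DensityWaveFisherMoments

/-!
# Negative lemmas for crux `InfraredMinimumUncertainty` (stmt-AtomisticToContinuum-11784) — IX:
# slot calculus for product states, plane-wave algebra through the phase, and the AM–GM rung

Supports (does not close) stmt-AtomisticToContinuum-11784 (route `BECConjugateDomination`; picked line
`fisher-gaussian-density-mode`, gen-2 V-forms of `Theorems/BECConjugateDominationDefs.lean`).  Importable
form of §H (part 1 of 6) of the cdisprove seat's standing file `Cruxes/InfraredMinimumUncertainty/Disproof.lean`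
(generation 2).

* `slotFun` (`a(xⱼ)∏_{i≠j} f(xᵢ)`, complex Fubini = the tree's `integral_cellN_prod`),
  `slotFun_eq_prod`, `integral_slotFun_mul_slotFun` (**slot-pair integrals** under a factor with
  `∫_cell f² = 1`: diagonal `∫_cell a b`, off-diagonal `(∫_cell a f)(∫_cell b f)`);
* `cellWave_eq_exp_arg` (`e_k = e^{iθ_k}`), `cellWave_eq_cos_add_sin`, `cellWave_mul_conj`,
  `two_cos_arg_eq`, `two_sin_arg_mul_I_eq`, `integral_cell_cellWave_sq/_cube`, `integral_cell_conj_cellWave`,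
  `integral_cell_cellWave_mul_conj` (`= L³`), `norm_waveVec_e0_sq` (`‖k‖² = (2π/L)²`), `arg_waveVec_e0`;
* the **AM–GM rung** for EVERY admissible state and continuous field (data processing along the
  density-wave lift, no minimality, no density): `neg_pairing_sub_norm_sq_le`, `continuous_commutatorAmp`,
  **`fisherTestV_le_secondMoment`: `J^V_m(φ) ≤ 4 m₂/(N²‖k‖⁴)`**.
-/

noncomputable section

open MeasureTheory Filter Set
open scoped ENNReal NNReal Topology ComplexConjugate BigOperators

namespace Summit.AtomisticToContinuum.BoseEinsteinCondensation.Theorems.InfraredMinimumUncertainty.Negative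

open Literature.MathematicalPhysics.QuantumManyBody.BoseGas
open Summit.AtomisticToContinuum.BoseEinsteinCondensation.Theses.BECConjugateDomination
open Summit.AtomisticToContinuum.BoseEinsteinCondensation.Cruxes.InfraredMinimumUncertainty.FisherGaussianDensityMode
open Summit.AtomisticToContinuum.BoseEinsteinCondensation.Theorems.GaussianDominationCan.Negative
  (prodFun contDiff_prodFun fderiv_prodFun integral_cellN_prod)
open Summit.AtomisticToContinuum.BoseEinsteinCondensation.Theorems.StaticResponseBound.Negative
  (arg re_cellWave integral_norm_sq_eq_one phiMode argCLM argCLM_apply integral_cell_trig_combo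
    phiMode_sq integral_cell_phiMode_sq arg_intSMul isRepulsiveFiniteRange_zero)
open Summit.AtomisticToContinuum.BoseEinsteinCondensation.Theorems.CorrectorClosure.Negative
  (e0 e0_ne_zero sideLength_succ_pos)

/-! ### Slot calculus for product states on `cell^N` -/

section SlotCalculus

variable {L : ℝ} {N : ℕ}

/-- The one-slot insertion `a^{(j)}(X) = a(xⱼ) · ∏_{i ≠ j} f(xᵢ)` into the product state `f^{⊗N}`. -/
def slotFun (f a : Space → ℂ) (j : Fin N) (X : Config N) : ℂ :=
  a (X j) * ∏ i ∈ Finset.univ.erase j, f (X i)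

/-- `a^{(j)}` as a full product over the slots. [folklore] -/
theorem slotFun_eq_prod (f a : Space → ℂ) (j : Fin N) (X : Config N) :
    slotFun f a j X = ∏ i, (if i = j then a else f) (X i) := by
  unfold slotFun
  rw [← Finset.mul_prod_erase Finset.univ (fun i => (if i = j then a else f) (X i))
    (Finset.mem_univ j)]
  simp only [if_true]
  congr 1
  exact Finset.prod_congr rfl fun i hi => by rw [if_neg (Finset.ne_of_mem_erase hi)]

/-- **Slot-pair integrals** under a factor with `∫_cell f² = 1`: the diagonal pair gives
`∫_cell a b`, an off-diagonal pair factorises as `(∫_cell a f)(∫_cell b f)`. [folklore] -/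
theorem integral_slotFun_mul_slotFun {f : Space → ℂ} (hf1 : ∫ x in cell L, f x * f x = 1)
    (a b : Space → ℂ) (j l : Fin N) :
    ∫ X in cellN N L, slotFun f a j X * slotFun f b l X =
      if j = l then ∫ x in cell L, a x * b x
      else (∫ x in cell L, a x * f x) * ∫ x in cell L, b x * f x := by
  have hpt : ∀ X : Config N, slotFun f a j X * slotFun f b l X =
      ∏ i, ((if i = j then a else f) (X i) * (if i = l then b else f) (X i)) := by
    intro X
    rw [slotFun_eq_prod, slotFun_eq_prod, ← Finset.prod_mul_distrib]
  simp_rw [hpt]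
  rw [integral_cellN_prod (L := L) (fun i x => (if i = j then a else f) x * (if i = l then b else f) x)]
  set F : Fin N → ℂ := fun i => ∫ x in cell L, (if i = j then a else f) x * (if i = l then b else f) x
    with hF
  change ∏ i, F i = _
  rw [← Finset.mul_prod_erase Finset.univ F (Finset.mem_univ j)]
  by_cases hjl : j = l
  · subst hjl
    have hFj : F j = ∫ x in cell L, a x * b x := by simp only [hF, if_true]
    have hFi : ∀ i ∈ Finset.univ.erase j, F i = 1 := fun i hi => by
      simp only [hF, if_neg (Finset.ne_of_mem_erase hi)]
      exact hf1
    rw [if_pos rfl, hFj, Finset.prod_eq_one hFi, mul_one]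
  · have hFj : F j = ∫ x in cell L, a x * f x := by simp only [hF, if_true, if_neg hjl]
    have hl : l ∈ Finset.univ.erase j := Finset.mem_erase.mpr ⟨Ne.symm hjl, Finset.mem_univ l⟩
    have hFl : F l = ∫ x in cell L, b x * f x := by
      simp only [hF, if_true, if_neg (Ne.symm hjl)]
      exact integral_congr_ae (Eventually.of_forall fun x => mul_comm _ _)
    have hFi : ∀ i ∈ (Finset.univ.erase j).erase l, F i = 1 := fun i hi => by
      have hil : i ≠ l := Finset.ne_of_mem_erase hi
      have hij : i ≠ j := Finset.ne_of_mem_erase (Finset.mem_of_mem_erase hi)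
      simp only [hF, if_neg hil, if_neg hij]
      exact hf1
    rw [if_neg hjl, ← Finset.mul_prod_erase _ F hl, hFj, hFl, Finset.prod_eq_one hFi, mul_one]

end SlotCalculus

/-! ### The plane wave through the phase; the wave vector of the mode `e₀` -/

section Phase

variable {L : ℝ}

/-- `e_k(x) = exp(i θ_k(x))`. [folklore] -/
theorem cellWave_eq_exp_arg (L : ℝ) (k : Fin 3 → ℤ) (x : Space) :
    cellWave L k x = Complex.exp ((arg L k x : ℂ) * Complex.I) := by
  rw [cellWave_apply]
  congr 1
  unfold arg
  push_cast
  ring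

/-- `e_k = cos θ_k + i sin θ_k`. [folklore] -/
theorem cellWave_eq_cos_add_sin (L : ℝ) (k : Fin 3 → ℤ) (x : Space) :
    cellWave L k x = (Real.cos (arg L k x) : ℂ) + (Real.sin (arg L k x) : ℂ) * Complex.I := by
  rw [cellWave_eq_exp_arg, Complex.exp_mul_I, Complex.ofReal_cos, Complex.ofReal_sin]

/-- `e_k ē_k = 1`. [folklore] -/
theorem cellWave_mul_conj (L : ℝ) (k : Fin 3 → ℤ) (x : Space) :
    cellWave L k x * conj (cellWave L k x) = 1 := by
  rw [Complex.mul_conj, Complex.normSq_eq_norm_sq, norm_cellWave]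
  simp

/-- `2 cos θ_k = e_k + ē_k`. [folklore] -/
theorem two_cos_arg_eq (L : ℝ) (k : Fin 3 → ℤ) (x : Space) :
    (2 * Real.cos (arg L k x) : ℂ) = cellWave L k x + conj (cellWave L k x) := by
  rw [cellWave_eq_cos_add_sin, map_add, map_mul, Complex.conj_ofReal, Complex.conj_ofReal,
    Complex.conj_I]
  ring

/-- `2i sin θ_k = e_k − ē_k`. [folklore] -/
theorem two_sin_arg_mul_I_eq (L : ℝ) (k : Fin 3 → ℤ) (x : Space) :
    (2 * Real.sin (arg L k x) : ℂ) * Complex.I = cellWave L k x - conj (cellWave L k x) := by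
  rw [cellWave_eq_cos_add_sin, map_add, map_mul, Complex.conj_ofReal, Complex.conj_ofReal,
    Complex.conj_I]
  ring

/-- `k + k ≠ 0` for `k ≠ 0` in `ℤ³`. [folklore] -/
theorem add_self_ne_zero_of_ne {k : Fin 3 → ℤ} (hk : k ≠ 0) : k + k ≠ 0 := by
  intro h
  apply hk
  funext j
  have := congrFun h j
  simp only [Pi.add_apply, Pi.zero_apply] at this
  simp only [Pi.zero_apply]
  omega

/-- `k + k + k ≠ 0` for `k ≠ 0` in `ℤ³`. [folklore] -/
theorem add_self_add_self_ne_zero_of_ne {k : Fin 3 → ℤ} (hk : k ≠ 0) : k + k + k ≠ 0 := by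
  intro h
  apply hk
  funext j
  have := congrFun h j
  simp only [Pi.add_apply, Pi.zero_apply] at this
  simp only [Pi.zero_apply]
  omega

/-- `∫_cell e_k² = 0` for `k ≠ 0` (the plane wave `e_{2k}`). [folklore] -/
theorem integral_cell_cellWave_sq (hL : 0 < L) {k : Fin 3 → ℤ} (hk : k ≠ 0) :
    ∫ x in cell L, cellWave L k x * cellWave L k x = 0 := by
  simp_rw [← cellWave_add_index]
  exact integral_cell_cellWave_eq_zero hL (add_self_ne_zero_of_ne hk)

/-- `∫_cell e_k³ = 0` for `k ≠ 0` (the plane wave `e_{3k}`). [folklore] -/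
theorem integral_cell_cellWave_cube (hL : 0 < L) {k : Fin 3 → ℤ} (hk : k ≠ 0) :
    ∫ x in cell L, cellWave L k x * cellWave L k x * cellWave L k x = 0 := by
  simp_rw [← cellWave_add_index]
  exact integral_cell_cellWave_eq_zero hL (add_self_add_self_ne_zero_of_ne hk)

/-- `∫_cell ē_k = 0` for `k ≠ 0` (the plane wave `e_{-k}`). [folklore] -/
theorem integral_cell_conj_cellWave (hL : 0 < L) {k : Fin 3 → ℤ} (hk : k ≠ 0) :
    ∫ x in cell L, conj (cellWave L k x) = 0 := by
  simp_rw [conj_cellWave]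
  exact integral_cell_cellWave_eq_zero hL (neg_ne_zero.mpr hk)

/-- `∫_cell e_k ē_k = L³`. [folklore] -/
theorem integral_cell_cellWave_mul_conj (hL : 0 < L) (k : Fin 3 → ℤ) :
    ∫ x in cell L, cellWave L k x * conj (cellWave L k x) = (L : ℂ) ^ 3 := by
  simp_rw [cellWave_mul_conj]
  have h := integral_cell_cellWave_zero hL
  simp_rw [cellWave_zero] at h
  exact h

/-- `‖k‖² = (2π/L)²` for the mode `e₀`. [folklore] -/
theorem norm_waveVec_e0_sq (L : ℝ) : ‖waveVec L e0‖ ^ 2 = (2 * Real.pi / L) ^ 2 := by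
  rw [EuclideanSpace.norm_eq, Real.sq_sqrt (Finset.sum_nonneg fun i _ => by positivity)]
  simp [waveVec_apply, e0, Pi.single_apply]

/-- `θ_{e₀}(k) = ‖k‖²` for `k = waveVec L e₀`. [folklore] -/
theorem arg_waveVec_e0 (L : ℝ) : arg L e0 (waveVec L e0) = (2 * Real.pi / L) ^ 2 := by
  unfold arg
  simp only [waveVec_apply, e0, Pi.single_apply, Fin.sum_univ_three]
  simp
  ring

end Phase

/-! ### The AM–GM rung: `J^V_m(φ) ≤ 4 m₂/(N² ‖k‖⁴)` for every state and every continuous field -/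

section Rung

variable {L : ℝ} {n : ℕ}

/-- Completion of the square: `−2c Re(ū W) − |u|² = c²|W|² − |u + cW|² ≤ c²|W|²`. [folklore] -/
theorem neg_pairing_sub_norm_sq_le (u W : ℂ) (c : ℝ) :
    -(2 * c) * (conj u * W).re - ‖u‖ ^ 2 ≤ c ^ 2 * ‖W‖ ^ 2 := by
  have h0 : 0 ≤ Complex.normSq (u + (c : ℂ) * W) := Complex.normSq_nonneg _
  rw [Complex.normSq_add, Complex.normSq_eq_norm_sq, Complex.normSq_eq_norm_sq, norm_mul,
    Complex.norm_real, Real.norm_eq_abs, mul_pow, sq_abs] at h0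
  have hre : (u * conj ((c : ℂ) * W)).re = c * (conj u * W).re := by
    rw [map_mul, Complex.conj_ofReal, show u * ((c : ℂ) * conj W) = (c : ℂ) * (u * conj W) by ring,
      Complex.re_ofReal_mul]
    congr 1
    rw [show conj u * W = conj (u * conj W) by rw [map_mul, Complex.conj_conj], Complex.conj_re]
  rw [hre] at h0
  nlinarith [h0]

/-- The commutator amplitude of an admissible (`C¹`) state is continuous. [folklore] -/
theorem continuous_commutatorAmp (Ψ : PeriodicTrialState (n + 1) L) (m : Fin 3 → ℤ) :
    Continuous fun X : Config (n + 1) => commutatorAmp (n + 1) L Ψ.ψ m X := by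
  unfold commutatorAmp
  refine continuous_finsetSum _ fun j _ => ?_
  refine ((continuous_cellWave L m).comp (continuous_apply j)).mul ?_
  refine (continuous_const.mul Ψ.contDiff.continuous).sub (continuous_const.mul ?_)
  exact (Ψ.contDiff.continuous_fderiv one_ne_zero).clm_apply continuous_const

/-- **The AM–GM rung** (data processing along the density-wave lift, no minimality, no density):
for every admissible state, every mode `m ≠ 0` and every continuous test field,
`J^V_m(φ) ≤ 4 m₂ /(N² ‖k‖⁴)`. [folklore] -/
theorem fisherTestV_le_secondMoment (hL : 0 < L) (Ψ : PeriodicTrialState (n + 1) L)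
    {m : Fin 3 → ℤ} (hm : m ≠ 0) {φ : ℂ → ℂ} (hφ : Continuous φ) :
    fisherTestV n L Ψ m φ ≤
      4 * secondMoment (n + 1) L Ψ.ψ m / (((n : ℝ) + 1) ^ 2 * ‖waveVec L m‖ ^ 4) := by
  rw [show ‖waveVec L m‖ ^ 4 = (‖waveVec L m‖ ^ 2) ^ 2 by ring]
  unfold fisherTestV secondMoment
  have hK : 0 < ‖waveVec L m‖ ^ 2 := pow_pos (norm_waveVec_pos hL hm) 2
  have hN : (0 : ℝ) < (n : ℝ) + 1 := by positivity
  set K : ℝ := ‖waveVec L m‖ ^ 2 with hKdef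
  set N : ℝ := (n : ℝ) + 1 with hNdef
  set c : ℝ := 2 / (N * K) with hcdef
  have hZ : Continuous fun X : Config (n + 1) => densityMode (n + 1) L m X := by
    unfold densityMode; fun_prop
  have hW := continuous_commutatorAmp Ψ m
  have hψ : Continuous Ψ.ψ := Ψ.contDiff.continuous
  set a : Config (n + 1) → ℝ := fun X => (conj (φ (densityMode (n + 1) L m X)) *
    commutatorAmp (n + 1) L Ψ.ψ m X * conj (Ψ.ψ X)).re with hadef
  set b : Config (n + 1) → ℝ := fun X => ‖φ (densityMode (n + 1) L m X)‖ ^ 2 * ‖Ψ.ψ X‖ ^ 2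
    with hbdef
  have ia : Integrable a (volume.restrict (cellN (n + 1) L)) :=
    integrableOn_cellN (Complex.continuous_re.comp ((((Complex.continuous_conj.comp (hφ.comp hZ)).mul
      hW).mul (Complex.continuous_conj.comp hψ)))) L
  have ib : Integrable b (volume.restrict (cellN (n + 1) L)) :=
    integrableOn_cellN ((((hφ.comp hZ).norm).pow 2).mul ((hψ.norm).pow 2)) L
  have iw : Integrable (fun X => c ^ 2 * ‖commutatorAmp (n + 1) L Ψ.ψ m X‖ ^ 2)
      (volume.restrict (cellN (n + 1) L)) :=
    (integrableOn_cellN ((hW.norm).pow 2) L).const_mul _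
  have hpt : ∀ X, -(2 * c) * a X - b X ≤ c ^ 2 * ‖commutatorAmp (n + 1) L Ψ.ψ m X‖ ^ 2 := by
    intro X
    have h := neg_pairing_sub_norm_sq_le (φ (densityMode (n + 1) L m X) * Ψ.ψ X)
      (commutatorAmp (n + 1) L Ψ.ψ m X) c
    have e1 : conj (φ (densityMode (n + 1) L m X) * Ψ.ψ X) * commutatorAmp (n + 1) L Ψ.ψ m X =
        conj (φ (densityMode (n + 1) L m X)) * commutatorAmp (n + 1) L Ψ.ψ m X * conj (Ψ.ψ X) := by
      rw [map_mul]; ring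
    rw [e1, norm_mul, mul_pow] at h
    exact h
  have h4 : -(4 / (N * K)) = -(2 * c) := by rw [hcdef]; ring
  calc -(4 / (N * K)) * (∫ X in cellN (n + 1) L, a X) - ∫ X in cellN (n + 1) L, b X
      = ∫ X in cellN (n + 1) L, (-(2 * c) * a X - b X) := by
        rw [integral_sub (ia.const_mul _) ib, integral_const_mul, h4]
    _ ≤ ∫ X in cellN (n + 1) L, c ^ 2 * ‖commutatorAmp (n + 1) L Ψ.ψ m X‖ ^ 2 :=
        integral_mono ((ia.const_mul _).sub ib) iw hpt
    _ = 4 * (∫ X in cellN (n + 1) L, ‖commutatorAmp (n + 1) L Ψ.ψ m X‖ ^ 2) / (N ^ 2 * K ^ 2) := by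
        rw [integral_const_mul, hcdef]
        field_simp
        ring

end Rung

end Summit.AtomisticToContinuum.BoseEinsteinCondensation.Theorems.InfraredMinimumUncertainty.Negative

end
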